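import Mathlib
import HarnessLib
import Summits.Parity.GeneralizedHardyLittlewood.Theses.LiouvilleMAD
import Literature.NumberTheory.LFunctions.QuasiRHFacts
import Literature.NumberTheory.LFunctions.LittlewoodCriterion

/-!
# `TypeIILiouville` (crux stmt-Parity-13322, route `LiouvilleMAD`) — negative side, line `Sketch`
# (resonance converse): power-saving Type II for `λ(mn − 1)` forces a zero-free strip for `ζ`

SKELETON of the line lead (prover-line-stmt-Parity-13322-0). Composition:

* `stub_A`  (the ONLY use of the crux, `c = −1`, coefficients 0/1): `TypeIILiouville` ⇒
  `|∑_{N<p≤2N} ∑_{k≤y, p ∣ k+1} λ(k)| ≤ C₁ y N^{−δ₁}` for `y ≥ N²` — separation of the cutoff `mp ≤ y+1` by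
  the route's own Vaughan-engine pieces (`TypeIIToLevel.typeII_rect`, `TypeIIToLevel.abs_block_le`).
* `stub_B`  (orthogonality mod `p` and `λ(pk) = −λ(k)`): the class sum is `(L(y) + L(y/p))/(p−1)` plus
  `(1/(p−1)) ∑_{χ ≠ χ₀} χ(−1) ∑_{k≤y} λ(k)χ(k)`.
* `stub_U2mu` (analytic core): power-saving `∑_{n≤N} χ(n)μ(n) ≪ N^{1−ε/2}` for `χ ≠ χ₀ mod q ≤ N^ε` whose
  `L(s,χ)` has no zero in `[1−δ₀, 1) × [−N^ε−1, N^ε+1]` (Perron + Borel–Carathéodory at constant width);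
  `stub_U2` transports it to `∑_{k≤N} λ(k)χ(k)` (`q ≤ N^{ε/2}`).
* `stub_V`  (Bombieri's log-free density theorem + `stub_U2` + `stub_B`): the non-principal remainder over
  the primes `p ∈ (N, 2N]`, `N ≍ y^θ`, is `≪ y^{1−δ₂}`.
* `stub_C`  (assembly, `∑_{N<p≤2N} 1/p ≫ 1/log N`): `|L(x)| ≤ C x^{1−δ}` with `0 < δ < 1/2`.
* `stub_D`  (`M(x) = ∑_{d ≤ √x} μ(d) L(x/d²)`): the same power saving for the Mertens function.
* `stepE`   (tree, PROVED: Landau–Littlewood `quasiRiemannHypothesis_of_mertens_isBigO_holds`).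

Conclusion: `quasiRH_of_typeIILiouville : TypeIILiouville → ∃ δ > 0, QuasiRiemannHypothesis (1 − δ)`
(= route Strip's crux `StripZeroFreeStrip` of the summit RiemannHypothesis, `Iff.rfl`), and the negative
lemma `TypeIILiouville_false_of_zetaZerosNearOne`.
-/

noncomputable section

open Finset ArithmeticFunction Filter Asymptotics
open Literature.NumberTheory.LFunctions

namespace Summit.Parity.GeneralizedHardyLittlewood.Theorems.TypeIILiouville

open Summit.Parity.GeneralizedHardyLittlewood.Theses.LiouvilleMAD (TypeIILiouville)

/-! ## Stub A — the crux at `c = −1` against `𝟙_{(M,2M]} ⊗ 𝟙_{primes}`: prime-class sums -/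

/-- **Stub A.** `TypeIILiouville` ⇒ a power saving for `Q_N(y) = ∑_{N<p≤2N} ∑_{k≤y, p ∣ k+1} λ(k)`
(`y ≥ N²`, `N ≥ 2`). -/
theorem stub_A (h : TypeIILiouville) :
    ∃ δ₁ : ℝ, 0 < δ₁ ∧ ∃ C₁ : ℝ, ∀ N : ℕ, 2 ≤ N → ∀ y : ℕ, N ^ 2 ≤ y →
      |∑ p ∈ (Ioc N (2 * N)).filter Nat.Prime,
          ∑ k ∈ (Icc 1 y).filter (fun k => p ∣ k + 1), (liouville k : ℝ)| ≤
        C₁ * y * (N : ℝ) ^ (-δ₁) := by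
  sorry

/-! ## Stub B — characters mod `p`: principal share and the non-principal remainder -/

/-- **Stub B.** For `p` prime and `y : ℕ`:
`∑_{k≤y, p∣k+1} λ(k) = (L(y) + L(⌊y/p⌋))/(p−1) + (1/(p−1)) ∑_{χ≠χ₀ mod p} χ(−1) ∑_{k≤y} λ(k)χ(k)`. -/
theorem stub_B (p : ℕ) [Fact p.Prime] (y : ℕ) :
    (∑ k ∈ (Icc 1 y).filter (fun k => p ∣ k + 1), (liouville k : ℂ)) =
      ((liouvilleSum (y : ℝ) : ℂ) + (liouvilleSum ((y / p : ℕ) : ℝ) : ℂ)) / ((p : ℂ) - 1) +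
        (1 / ((p : ℂ) - 1)) * ∑ χ ∈ (univ : Finset (DirichletCharacter ℂ p)).erase 1,
          χ (-1) * ∑ k ∈ Icc 1 y, (liouville k : ℂ) * χ (k : ZMod p) := by
  sorry

/-! ## Stub U2mu — twisted Möbius sums from a zero-free box of CONSTANT width (power saving) -/

/-- **Stub U2mu** (the analytic core; Perron's formula moved to `Re s = 1 − δ₀/2`, height `N^ε`,
Borel–Carathéodory bounds for `1/L` in the zero-free discs — the tree's `MoebiusCharSumLinnikBox` re-run
with a box of constant width). For `0 < δ₀ ≤ 1/4` there are `0 < ε ≤ δ₀`, `C`, `N₀` such that for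
`N ≥ N₀`, `q ≤ N^ε`, `χ ≠ χ₀ mod q` with `L(z, χ) ≠ 0` on `1 − δ₀ ≤ Re z < 1`, `|Im z| ≤ N^ε + 1`:
`‖∑_{n≤N} χ(n)μ(n)‖ ≤ C N^{1−ε/2}`. -/
theorem stub_U2mu : ∀ δ₀ : ℝ, 0 < δ₀ → δ₀ ≤ 1 / 4 → ∃ ε : ℝ, 0 < ε ∧ ε ≤ δ₀ ∧ ∃ C : ℝ, ∃ N₀ : ℕ,
    ∀ N : ℕ, N₀ ≤ N → ∀ (q : ℕ) [NeZero q], (q : ℝ) ≤ (N : ℝ) ^ ε →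
      ∀ χ : DirichletCharacter ℂ q, χ ≠ 1 →
        (∀ z : ℂ, 1 - δ₀ ≤ z.re → z.re < 1 → |z.im| ≤ (N : ℝ) ^ ε + 1 → χ.LFunction z ≠ 0) →
        ‖∑ n ∈ Icc 1 N, χ (n : ZMod q) * (ArithmeticFunction.moebius n : ℂ)‖ ≤
          C * (N : ℝ) ^ (1 - ε / 2) := by
  sorry

/-! ## Stub U2 — from `μχ` to `λχ` (`λ = 𝟙_□ ⋆ μ`) -/

/-- **Stub U2.** Given Stub U2mu (as `hμ`): for `0 < δ₀ ≤ 1/4` there are `0 < ε ≤ δ₀`, `C`, `N₀` such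
that for `N ≥ N₀`, `q ≤ N^{ε/2}`, `χ ≠ χ₀ mod q` with `L(z, χ) ≠ 0` on `1 − δ₀ ≤ Re z < 1`,
`|Im z| ≤ N^ε + 1`: `‖∑_{k≤N} λ(k)χ(k)‖ ≤ C N^{1−ε/2}` (`∑_{k≤N} λχ = ∑_{r²≤N} χ(r)² M(N/r², χ)`,
tree `LiouvilleCharSumLinnikBox.sum_liouville_twist_eq`; `r ≤ N^{1/4}` by `hμ`, larger `r` trivially). -/
theorem stub_U2
    (hμ : ∀ δ₀ : ℝ, 0 < δ₀ → δ₀ ≤ 1 / 4 → ∃ ε : ℝ, 0 < ε ∧ ε ≤ δ₀ ∧ ∃ C : ℝ, ∃ N₀ : ℕ,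
      ∀ N : ℕ, N₀ ≤ N → ∀ (q : ℕ) [NeZero q], (q : ℝ) ≤ (N : ℝ) ^ ε →
        ∀ χ : DirichletCharacter ℂ q, χ ≠ 1 →
          (∀ z : ℂ, 1 - δ₀ ≤ z.re → z.re < 1 → |z.im| ≤ (N : ℝ) ^ ε + 1 → χ.LFunction z ≠ 0) →
          ‖∑ n ∈ Icc 1 N, χ (n : ZMod q) * (ArithmeticFunction.moebius n : ℂ)‖ ≤
            C * (N : ℝ) ^ (1 - ε / 2)) :
    ∀ δ₀ : ℝ, 0 < δ₀ → δ₀ ≤ 1 / 4 → ∃ ε : ℝ, 0 < ε ∧ ε ≤ δ₀ ∧ ∃ C : ℝ, ∃ N₀ : ℕ,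
    ∀ N : ℕ, N₀ ≤ N → ∀ (q : ℕ) [NeZero q], (q : ℝ) ≤ (N : ℝ) ^ (ε / 2) →
      ∀ χ : DirichletCharacter ℂ q, χ ≠ 1 →
        (∀ z : ℂ, 1 - δ₀ ≤ z.re → z.re < 1 → |z.im| ≤ (N : ℝ) ^ ε + 1 → χ.LFunction z ≠ 0) →
        ‖∑ k ∈ Icc 1 N, (liouville k : ℂ) * χ (k : ZMod q)‖ ≤ C * (N : ℝ) ^ (1 - ε / 2) := by
  sorry

/-! ## Stub V — the non-principal remainder over `p ∈ (N, 2N]`, `N ≍ y^θ` -/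

/-- **Stub V.** From Stub B (as `hB`), Stub U2 (as `hU2`) and Bombieri's log-free density theorem
(tree): for some `0 < θ ≤ 1/4`, `δ₂ > 0`,
`|∑_{N<p≤2N} (∑_{k≤y, p∣k+1} λ(k) − (L(y)+L(⌊y/p⌋))/(p−1))| ≤ C₂ y^{1−δ₂}` whenever `y^θ/2 ≤ N ≤ y^θ`,
`y ≥ y₀`. -/
theorem stub_V
    (hB : ∀ (p : ℕ) [Fact p.Prime] (y : ℕ),
      (∑ k ∈ (Icc 1 y).filter (fun k => p ∣ k + 1), (liouville k : ℂ)) =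
        ((liouvilleSum (y : ℝ) : ℂ) + (liouvilleSum ((y / p : ℕ) : ℝ) : ℂ)) / ((p : ℂ) - 1) +
          (1 / ((p : ℂ) - 1)) * ∑ χ ∈ (univ : Finset (DirichletCharacter ℂ p)).erase 1,
            χ (-1) * ∑ k ∈ Icc 1 y, (liouville k : ℂ) * χ (k : ZMod p))
    (hU2 : ∀ δ₀ : ℝ, 0 < δ₀ → δ₀ ≤ 1 / 4 → ∃ ε : ℝ, 0 < ε ∧ ε ≤ δ₀ ∧ ∃ C : ℝ, ∃ N₀ : ℕ,
      ∀ N : ℕ, N₀ ≤ N → ∀ (q : ℕ) [NeZero q], (q : ℝ) ≤ (N : ℝ) ^ (ε / 2) →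
        ∀ χ : DirichletCharacter ℂ q, χ ≠ 1 →
          (∀ z : ℂ, 1 - δ₀ ≤ z.re → z.re < 1 → |z.im| ≤ (N : ℝ) ^ ε + 1 → χ.LFunction z ≠ 0) →
          ‖∑ k ∈ Icc 1 N, (liouville k : ℂ) * χ (k : ZMod q)‖ ≤ C * (N : ℝ) ^ (1 - ε / 2)) :
    ∃ θ : ℝ, 0 < θ ∧ θ ≤ 1 / 4 ∧ ∃ δ₂ : ℝ, 0 < δ₂ ∧ ∃ C₂ : ℝ, ∃ y₀ : ℕ, ∀ y : ℕ, y₀ ≤ y →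
      ∀ N : ℕ, (y : ℝ) ^ θ / 2 ≤ N → (N : ℝ) ≤ (y : ℝ) ^ θ →
        |∑ p ∈ (Ioc N (2 * N)).filter Nat.Prime,
            ((∑ k ∈ (Icc 1 y).filter (fun k => p ∣ k + 1), (liouville k : ℝ)) -
              ((liouvilleSum (y : ℝ) : ℝ) + (liouvilleSum ((y / p : ℕ) : ℝ) : ℝ)) / ((p : ℝ) - 1))| ≤
          C₂ * (y : ℝ) ^ (1 - δ₂) := by
  sorry

/-! ## Stub C — assembly: a power saving for `L(x) = ∑_{n≤x} λ(n)` -/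

/-- **Stub C.** From the conclusions of Stubs A and V: `|L(x)| ≤ C x^{1−δ}` for `x ≥ x₀`, some
`0 < δ < 1/2` (identity `(∑_p 1/(p−1)) L(y) = Q_N(y) − R_N(y) − ∑_p L(⌊y/p⌋)/(p−1)`, `N = ⌊y^θ⌋`,
`∑_{N<p≤2N} 1/p ≫ 1/log N`). -/
theorem stub_C
    (hA : ∃ δ₁ : ℝ, 0 < δ₁ ∧ ∃ C₁ : ℝ, ∀ N : ℕ, 2 ≤ N → ∀ y : ℕ, N ^ 2 ≤ y →
      |∑ p ∈ (Ioc N (2 * N)).filter Nat.Prime,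
          ∑ k ∈ (Icc 1 y).filter (fun k => p ∣ k + 1), (liouville k : ℝ)| ≤
        C₁ * y * (N : ℝ) ^ (-δ₁))
    (hV : ∃ θ : ℝ, 0 < θ ∧ θ ≤ 1 / 4 ∧ ∃ δ₂ : ℝ, 0 < δ₂ ∧ ∃ C₂ : ℝ, ∃ y₀ : ℕ, ∀ y : ℕ, y₀ ≤ y →
      ∀ N : ℕ, (y : ℝ) ^ θ / 2 ≤ N → (N : ℝ) ≤ (y : ℝ) ^ θ →
        |∑ p ∈ (Ioc N (2 * N)).filter Nat.Prime,
            ((∑ k ∈ (Icc 1 y).filter (fun k => p ∣ k + 1), (liouville k : ℝ)) -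
              ((liouvilleSum (y : ℝ) : ℝ) + (liouvilleSum ((y / p : ℕ) : ℝ) : ℝ)) / ((p : ℝ) - 1))| ≤
          C₂ * (y : ℝ) ^ (1 - δ₂)) :
    ∃ δ : ℝ, 0 < δ ∧ δ < 1 / 2 ∧ ∃ C x₀ : ℝ, ∀ x : ℝ, x₀ ≤ x →
      |(liouvilleSum x : ℝ)| ≤ C * x ^ (1 - δ) := by
  sorry

/-! ## Stub D — from `λ` to `μ` -/

/-- **Stub D.** `μ(n) = ∑_{d² ∣ n} μ(d) λ(n/d²)`, so `M(x) = ∑_{d≤√x} μ(d) L(x/d²)` and a power saving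
`δ < 1/2` passes from `L` to `M`. -/
theorem stub_D : ∀ δ : ℝ, 0 < δ → δ < 1 / 2 →
    (∃ C x₀ : ℝ, ∀ x : ℝ, x₀ ≤ x → |(liouvilleSum x : ℝ)| ≤ C * x ^ (1 - δ)) →
      ∃ C x₀ : ℝ, ∀ x : ℝ, x₀ ≤ x → |(mertensFunction x : ℝ)| ≤ C * x ^ (1 - δ) := by
  sorry

/-! ## Step E (tree) and the composition -/

/-- **Step E** (Landau–Littlewood–Titchmarsh, PROVED in the tree:
`quasiRiemannHypothesis_of_mertens_isBigO_holds`): a power saving `x^{1−δ}` for the Mertens function is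
the quasi-Riemann hypothesis at abscissa `1 − δ`. -/
theorem stepE {δ : ℝ} (hδ0 : 0 < δ) (hδ1 : δ < 1)
    (h : ∃ C x₀ : ℝ, ∀ x : ℝ, x₀ ≤ x → |(mertensFunction x : ℝ)| ≤ C * x ^ (1 - δ)) :
    QuasiRiemannHypothesis (1 - δ) := by
  refine quasiRiemannHypothesis_of_mertens_isBigO_holds (1 - δ) (by linarith) (by linarith) ?_
  obtain ⟨C, x₀, hC⟩ := h
  rw [Asymptotics.isBigO_iff]
  refine ⟨C, ?_⟩
  filter_upwards [eventually_ge_atTop x₀, eventually_ge_atTop (0 : ℝ)] with x hx hx0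
  rw [Real.norm_eq_abs, Real.norm_eq_abs, abs_of_nonneg (Real.rpow_nonneg hx0 _)]
  exact hC x hx

/-- **The resonance converse.** Power-saving Type II information for `λ(mn + c)` on the balanced range
(the crux `TypeIILiouville` of route `LiouvilleMAD`, used only at `c = −1` with 0/1 coefficients) implies
a zero-free vertical strip `1 − δ < Re s < 1` for `ζ` — route Strip's crux `StripZeroFreeStrip` of the
summit `RiemannHypothesis` (`Iff.rfl`). -/
theorem quasiRH_of_typeIILiouville (h : TypeIILiouville) :
    ∃ δ : ℝ, 0 < δ ∧ QuasiRiemannHypothesis (1 - δ) := by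
  obtain ⟨δ, hδ0, hδ2, hL⟩ := stub_C (stub_A h) (stub_V stub_B (stub_U2 stub_U2mu))
  exact ⟨δ, hδ0, stepE hδ0 (by linarith) (stub_D δ hδ0 hδ2 hL)⟩

/-- **Negative lemma** (`TypeIILiouville_false_of_zetaZerosNearOne`): if `ζ` has non-trivial zeros with
real part arbitrarily close to `1` (`Θ = sup Re ρ = 1`; expected false, refuted by nobody), then the crux
`TypeIILiouville` is false. -/
theorem TypeIILiouville_false_of_zetaZerosNearOne
    (hH : ∀ δ : ℝ, 0 < δ → ∃ s : ℂ, riemannZeta s = 0 ∧ 1 - δ < s.re ∧ s.re < 1) :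
    ¬ TypeIILiouville := by
  intro h
  obtain ⟨δ, hδ, hQ⟩ := quasiRH_of_typeIILiouville h
  obtain ⟨s, hs0, hs1, hs2⟩ := hH δ hδ
  exact hQ s hs0 hs1 hs2

/-- **The target of this (negative) line, as one proposition**: zeros of `ζ` accumulating at `Re s = 1`
refute the crux.  (A negative line cannot declare `TypeIILiouville_proof`; the skeleton is registered
against this declaration instead, `--crux-decl …NegativeTarget`.) -/
def NegativeTarget : Prop :=
  (∀ δ : ℝ, 0 < δ → ∃ s : ℂ, riemannZeta s = 0 ∧ 1 - δ < s.re ∧ s.re < 1) → ¬ TypeIILiouville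

/-- The composition closes `NegativeTarget` modulo the registered stubs. -/
theorem NegativeTarget_proof : NegativeTarget := TypeIILiouville_false_of_zetaZerosNearOne

end Summit.Parity.GeneralizedHardyLittlewood.Theorems.TypeIILiouville

end
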